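import Summits.ABC.ABC.Theorems.DefiniteXiDefiniteRTControlPrimeTwoFacts
import HarnessLib

/-!
# Line `TwoFacts` — crux `DefiniteXi.DefiniteRTControlPrime` (stmt-ABC-11338): 2-stub skeleton CANDIDATE

Status: CANDIDATE, NOT REGISTERED (written by stub-ideation k3 g13, which may not touch the registered
skeleton).  A seat with registration rights (lead / cruxplan / cstrat / operator) registers it with

  ledger skeleton check "$(ledger crux dir stmt-ABC-11338)/Lines/TwoFacts.lean" --crux stmt-ABC-11338

which keeps the two surviving stubs VERBATIM (same names, same signatures as in `Lines/Sketch.lean`,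
so their STUB-IDEAS threads stay valid) and expires the redundant `stub_pastenLemma68`
(`PastenShimura2024_lemma_6_8`, Mazur–Kenku-complete as typed and not needed by the crux).

Composition = the LANDED theorem `definiteRTControlPrime_of_two_facts` (p838145,
`Theorems/DefiniteXiDefiniteRTControlPrimeTwoFacts.lean`): the crux from Takahashi 2001 Thm 2.3 (coprime
form) and Pasten's `163·δ` bound alone, `C = 4·163³`.
-/

set_option linter.dupNamespace false

namespace Summit.ABC.ABC.Cruxes.DefiniteRTControlPrime.TwoFacts

open Literature.NumberTheory.EllipticCurves
open Literature.NumberTheory.EllipticCurves.ModularForms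
open Summit.ABC.ABC.Theses.DefiniteXi

/-- stub 1 (named fact, VERBATIM as in `Lines/Sketch.lean`): Takahashi 2001 Thm 2.3, coprime form.
[cite: Takahashi2001, Thm. 2.3 (p. 79)] -/
theorem stub_takahashi : takahashi2001_thm_2_3_of_coprime := by
  sorry

/-- stub 2 (named fact, VERBATIM as in `Lines/Sketch.lean`): Pasten 2024 §3, `deg D_min ≤ 163 · deg D_opt`.
[cite: PastenShimura2024, §3 p. 13] -/
theorem stub_pasten163 : PastenShimura2024_minimalDegree_le_163_mul := by
  sorry

/-- The crux BY NAME from the two stubs (kernel-checked composition = landed `…_of_two_facts`). -/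
theorem DefiniteRTControlPrime_of : Summit.ABC.ABC.Theses.DefiniteXi.DefiniteRTControlPrime :=
  Summit.ABC.ABC.Theorems.DefiniteRTControlPrime.definiteRTControlPrime_of_two_facts
    stub_takahashi stub_pasten163

end Summit.ABC.ABC.Cruxes.DefiniteRTControlPrime.TwoFacts
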